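import Summits.KontsevichZagierPeriods.KontsevichZagierPeriods.Theorems.SoloInformedToricMZV
import HarnessLib

/-!
# THEOREM ND on the open cube, sandwich domains, and arbitrary-subset zeta denominators

Solo programme `solo-KontsevichZagierPeriods-informed`, session s104 (closure properties, 3).

* `soloInformed_presentable_of_nondegenerate_rational_open`: THEOREM ND for all numerators
  (`soloInformed_presentable_of_nondegenerate_rational`) for representations whose domain is the
  OPEN cube `(0,1)ⁿ` (the form in which cube representations of multiple zeta values are filed,
  `soloInformedCubeW`), and `…_of_subset` for any domain between the open and the closed cube.
* `soloInformed_cubeNondegenerate_subsetZeta`: for every non-empty `S ⊆ {0,…,n-1}` the polynomial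
  `1 − ∏_{i∈S} (1 − xᵢ)` is cube-nondegenerate (the extension lemma applied along the order
  embedding `Fin |S| ↪ Fin n` onto `S`).

References: J. Ayoub, EMS Newsl. 91 (2014) §2.2; A. G. Kouchnirenko, Invent. Math. 32 (1976) §1.
-/

noncomputable section

open scoped BigOperators
open MeasureTheory Set
open Literature.NumberTheory.Transcendental Literature.NumberTheory.Transcendental.KZ
open Literature.ModelTheory.ExponentialFields (IsSemialgebraic)
open Literature.AlgebraicGeometry.Resolution

namespace Summit.KontsevichZagierPeriods.KontsevichZagierPeriods.Theorems

variable {n : ℕ}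

/-- **THEOREM ND for all numerators on the open cube.**  Let `Q` be cube-nondegenerate, `P`
arbitrary, and `r₀` an `IntegralRep` with domain `(0,1)ⁿ` and integrand `P/Q` there.  Then `of r₀`
is presentable. [this work] -/
theorem soloInformed_presentable_of_nondegenerate_rational_open (P Q : MvPolynomial (Fin n) ℚ)
    (hND : SoloInformedCubeNondegenerate Q) (r₀ : IntegralRep n)
    (hr₀ : r₀.domain = soloInformedOpenCube n)
    (hri : EqOn r₀.integrand (fun x => MvPolynomial.aeval x P / MvPolynomial.aeval x Q)
      (soloInformedOpenCube n)) :
    of r₀ ∈ soloInformedPresentable := by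
  classical
  have hQ : ∀ x ∈ soloInformedOpenCube n, MvPolynomial.aeval x Q ≠ 0 := fun x hx =>
    soloInformed_aeval_ne_zero_of_nondegenerate hND fun i => ⟨(hx i).1, (hx i).2.le⟩
  have hint : IntegrableOn (fun x => MvPolynomial.aeval x P / MvPolynomial.aeval x Q)
      (soloInformedOpenCube n) := by
    have h := r₀.integrableOn.congr_fun (fun x hx => hri (by rwa [hr₀] at hx))
      r₀.measurableSet_domain_holds
    rwa [hr₀] at h
  -- termwise integrability (Laurent test on the toric charts)
  have hterm : ∀ a ∈ P.support, IntegrableOn (fun x => (∏ j, x j ^ a j) / MvPolynomial.aeval x Q)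
      (soloInformedOpenCube n) := fun a ha => soloInformed_integrableOn_monomial_div P Q hND hint ha
  -- the truncated representations `[(0,1)ⁿ, P_t/Q]`
  set ρ : Finset (Fin n →₀ ℕ) → IntegralRep n := fun t =>
    if ht : t ⊆ P.support then
      IntegralRep.ofRational (soloInformedOpenCube n) (soloInformedTrunc P t) Q
        (isSemialgebraic_soloInformedOpenCube n) hQ
        (soloInformed_integrableOn_trunc_div_of_terms P Q t fun a ha => hterm a (ht ha))
    else r₀ with hρ
  have hρdom : ∀ t, (ρ t).domain = soloInformedOpenCube n := fun t => by
    by_cases ht : t ⊆ P.support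
    · simp only [hρ, ht, dif_pos]; rfl
    · simp only [hρ, ht, dif_neg, not_false_eq_true]; exact hr₀
  have hρi : ∀ t, t ⊆ P.support → ∀ x, (ρ t).integrand x =
      MvPolynomial.aeval x (soloInformedTrunc P t) / MvPolynomial.aeval x Q := fun t ht x => by
    simp only [hρ, ht, dif_pos]; rfl
  -- integrand additivity along the support
  have hsplit : ∀ t, t ⊆ P.support → of (ρ t) - ∑ a ∈ t, of (ρ {a}) ∈ relations := by
    intro t
    induction t using Finset.induction_on with
    | empty =>
      intro _
      rw [Finset.sum_empty, sub_zero]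
      exact of_mem_relations_of_eqOn_zero _ fun x _ => by
        rw [hρi ∅ (Finset.empty_subset _)]
        simp [soloInformedTrunc]
    | insert b t hb ih =>
      intro hbt
      have ht : t ⊆ P.support := (Finset.subset_insert b t).trans hbt
      have hb' : {b} ⊆ P.support :=
        Finset.singleton_subset_iff.2 (hbt (Finset.mem_insert_self b t))
      have h1 : of (ρ (insert b t)) - of (ρ {b}) - of (ρ t) ∈ relations :=
        integrandAddRel_subset_relations ⟨n, ρ (insert b t), ρ {b}, ρ t,
          by rw [hρdom, hρdom], by rw [hρdom, hρdom], fun x _ => by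
            rw [Pi.add_apply, hρi _ hbt, hρi _ hb', hρi _ ht, soloInformed_aeval_trunc,
              soloInformed_aeval_trunc, soloInformed_aeval_trunc, Finset.sum_insert hb,
              Finset.sum_singleton, add_div], rfl⟩
      rw [Finset.sum_insert hb]
      have : of (ρ (insert b t)) - (of (ρ {b}) + ∑ a ∈ t, of (ρ {a})) =
          (of (ρ (insert b t)) - of (ρ {b}) - of (ρ t)) + (of (ρ t) - ∑ a ∈ t, of (ρ {a})) := by
        abel
      rw [this]
      exact relations.add_mem h1 (ih ht)
  -- `r₀` versus the full truncation
  have hfull : of r₀ - of (ρ P.support) ∈ relations :=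
    of_sub_of_mem_relations_of_eqOn (by rw [hρdom, hr₀]) fun x hx => by
      rw [hρi _ Subset.rfl, hri (by rwa [hr₀] at hx)]
      unfold soloInformedTrunc
      rw [← MvPolynomial.as_sum P]
  -- each monomial piece by THEOREM ND
  have hpiece : ∀ a ∈ P.support, of (ρ {a}) ∈ soloInformedPresentable := by
    intro a ha
    have hca : MvPolynomial.coeff a P ≠ 0 := MvPolynomial.mem_support_iff.1 ha
    have ha' : {a} ⊆ P.support := Finset.singleton_subset_iff.2 ha
    refine soloInformed_presentable_of_nondegenerate_of_subset a
      ((MvPolynomial.coeff a P)⁻¹ • Q) (soloInformed_cubeNondegenerate_smul hND (inv_ne_zero hca))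
      (ρ {a}) (by rw [hρdom]) (by rw [hρdom]; exact soloInformedOpenCube_subset_cube n)
      fun x hx => ?_
    show _ = (∏ j, x j ^ a j) / MvPolynomial.aeval x ((MvPolynomial.coeff a P)⁻¹ • Q)
    rw [hρi _ ha', soloInformed_aeval_trunc, Finset.sum_singleton, map_smul, Algebra.smul_def,
      eq_ratCast, eq_ratCast, Rat.cast_inv]
    have h1 : ((MvPolynomial.coeff a P : ℚ) : ℝ) ≠ 0 := by exact_mod_cast hca
    have h2 : MvPolynomial.aeval x Q ≠ 0 := hQ x hx
    field_simp
  -- assemble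
  have hsum : ∑ a ∈ P.support, of (ρ {a}) ∈ soloInformedPresentable :=
    soloInformed_presentable_sum _ _ hpiece
  exact soloInformed_presentable_of_sub_mem hfull
    (soloInformed_presentable_of_sub_mem (hsplit _ Subset.rfl) hsum)


/-- **THEOREM ND for all numerators, sandwich domains**: any `IntegralRep` whose domain lies
between the open and the closed unit cube and whose integrand is `P/Q` on the open cube, `Q`
cube-nondegenerate, is presentable. [this work] -/
theorem soloInformed_presentable_of_nondegenerate_rational_of_subset
    (P Q : MvPolynomial (Fin n) ℚ) (hND : SoloInformedCubeNondegenerate Q) (r : IntegralRep n)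
    (hr₁ : soloInformedOpenCube n ⊆ r.domain) (hr₂ : r.domain ⊆ soloInformedCube n)
    (hri : EqOn r.integrand (fun x => MvPolynomial.aeval x P / MvPolynomial.aeval x Q)
      (soloInformedOpenCube n)) :
    of r ∈ soloInformedPresentable := by
  set r₀ := r.restrict (soloInformedOpenCube n) (isSemialgebraic_soloInformedOpenCube n) hr₁
    with hr₀
  have h₀ : of r - of r₀ ∈ relations :=
    r.of_sub_of_restrict_mem_relations (isSemialgebraic_soloInformedOpenCube n) hr₁
      (measure_mono_null (fun x (hx : x ∈ r.domain \ soloInformedOpenCube n) =>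
        show x ∈ soloInformedCube n \ soloInformedOpenCube n from ⟨hr₂ hx.1, hx.2⟩)
        (soloInformed_volume_cube_diff_openCube n))
  exact soloInformed_presentable_of_sub_mem h₀
    (soloInformed_presentable_of_nondegenerate_rational_open P Q hND r₀ rfl fun x hx => hri hx)

/-- **Arbitrary-subset zeta denominators are cube-nondegenerate**: for every non-empty
`S ⊆ {0, …, n-1}`, `1 − ∏_{i∈S} (1 − xᵢ)` is cube-nondegenerate. [this work] -/
theorem soloInformed_cubeNondegenerate_subsetZeta (S : Finset (Fin n)) (hS : S.Nonempty) :
    SoloInformedCubeNondegenerate (1 - ∏ i ∈ S, (1 - MvPolynomial.X i) :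
      MvPolynomial (Fin n) ℚ) := by
  have hk : 0 < S.card := Finset.card_pos.2 hS
  have h := soloInformed_cubeNondegenerate_rename (S.orderEmbOfFin rfl)
    (S.orderEmbOfFin rfl).injective (soloInformed_cubeNondegenerate_zetaDenominator hk)
  have hQ : MvPolynomial.rename (S.orderEmbOfFin rfl) (soloInformedZetaDenominator S.card) =
      (1 - ∏ i ∈ S, (1 - MvPolynomial.X i) : MvPolynomial (Fin n) ℚ) := by
    unfold soloInformedZetaDenominator
    simp only [map_sub, map_one, map_prod, MvPolynomial.rename_X]
    conv_rhs => rw [← Finset.image_orderEmbOfFin_univ S rfl]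
    rw [Finset.prod_image (S.orderEmbOfFin rfl).injective.injOn]
  rwa [hQ] at h

/-- The sandwich theorem in the output format of the cube crux. [this work] -/
theorem soloInformed_cubeResolution_nondegenerate_rational_of_subset
    (P Q : MvPolynomial (Fin n) ℚ) (hND : SoloInformedCubeNondegenerate Q) (r : IntegralRep n)
    (hr₁ : soloInformedOpenCube n ⊆ r.domain) (hr₂ : r.domain ⊆ soloInformedCube n)
    (hri : EqOn r.integrand (fun x => MvPolynomial.aeval x P / MvPolynomial.aeval x Q)
      (soloInformedOpenCube n)) :
    ∃ (k : ℕ) (_ : k ≠ 0) (m : ℕ) (d : Fin m → ℕ) (G : ∀ j, SoloInformedCubeGerm (d j))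
      (c : Fin m → ℤ) (ρ : ∀ j, IntegralRep (d j)),
      (∀ j, (ρ j).domain = soloInformedCube (d j)) ∧
      (∀ j, EqOn (ρ j).integrand (fun x => ((G j).g (soloInformedToC (d j) x)).re)
        (soloInformedCube (d j))) ∧
      k • of r - ∑ j, c j • of (ρ j) ∈ relations :=
  soloInformed_exists_fin_of_presentable
    (soloInformed_presentable_of_nondegenerate_rational_of_subset P Q hND r hr₁ hr₂ hri)

end Summit.KontsevichZagierPeriods.KontsevichZagierPeriods.Theorems
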